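import Summits.QuantumFields.YangMills.Theorems.DirichletWindowXiDiverges
import Summits.QuantumFields.YangMills.Theorems.DirichletWindowAxialLogConvexity
import HarnessLib

/-!
# `ExponentialWindow → XiExpLowerBound`: the assembly of route `XiCompleteMonotonicity`, hypothesis-explicit
# (record; supports `XiDiverges`, item 8941)

Seat ym-idea-4 g7 (technique card «spectral / trace methods»), LINE-29 of the `S28ᵀ` lane. The
route `XiCompleteMonotonicity` (status draft: its route file does not build, see
`XiCompleteMonotonicityRecords`) has the open assembly item stmt-QuantumFields-8945,
`Assembly := AxialLogConvexity → ExponentialWindow → XiExpLowerBound`. This file proves that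
implication with the two recorded items named by their records
(`Theses.XiCompleteMonotonicity.AxialLogConvexity`, `.XiExpLowerBound`, ledger signatures
verbatim) and the unrecorded crux `ExponentialWindow` (item 8936) spelled out verbatim as the
hypothesis — and, since `AxialLogConvexity` is a theorem (`AxialLogConvexity_proof`), the
reduction of the route's target to its single open crux:

  `ExponentialWindow → XiExpLowerBound`   (`xiExpLowerBound_of_exponentialWindow`).

MECHANISM (transfer-matrix spectral positivity = monotonicity of effective masses). For a limit
state at `β ≥ β₁` put `a(k) = f_{β,μ}(k e₀)`: non-negative, non-increasing, `≤ N²`, log-convex from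
`1` on (`AxialLogConvexity.plaquetteCorrFn_axial`). Take the scale `t = ⌊e^{cβ}⌋ = M + 2`; the
window gives `a(t) ≥ A/(β² t⁸) > 0`. With `ε = max(0, log((N²+1) β² t⁸/A)/(t-1))` one has
`e^{-ε (t-1)} a(1) ≤ a(t)`, so the tree's chord lemma `xiDiverges_chord` (the effective masses
`log a(k) − log a(k+1)` are non-increasing, hence the last one inside `[1,t]` and every later one
is at most the chord slope `ε`) yields `a(t) e^{-ε k} ≤ a(k)` for all `k`; and
`ε ≤ (N² + |log A| + 2 + 8c) β / (e^{cβ}/2) = K β e^{-cβ}` for `β ≥ 1`, `e^{cβ} ≥ n₀ + 4`.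

HONEST FRAMING. `ExponentialWindow` (a lower bound `A/(β² n⁸)` on the axial plaquette correlation
out to distances `n ≤ e^{cβ}`, uniformly over limit states — weak-coupling input of asymptotic-
freedom strength) is NOT proved here and is the whole difficulty; no summit conjunct is touched;
the Yang–Mills mass gap is NOT proved. References: S. Chatterjee, *Yang–Mills for probabilists*
(2019) Problem 5.1 shape [ChatterjeeYMProb2019]; E. Seiler, LNP 159 (1982) Ch. 2 (transfer matrix,
monotone effective masses); the chord lemma is `Theorems.xiDiverges_chord` (folklore).
-/

noncomputable section

namespace Summit.QuantumFields.YangMills.Theorems.S28XiExpLowerBound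

open Real Filter
open Literature.MathematicalPhysics.QuantumFieldTheory Literature.MathematicalPhysics.QuantumLattice

/-- Real-variable bookkeeping of the scale: if `n₀ + 4 ≤ E` (`E = e^{cβ}`), the floor `t = ⌊E⌋`
is `M + 2` with `n₀ ≤ M + 2`, `M + 2 ≤ E` and `E/2 ≤ M + 1`. [folklore] -/
theorem exists_scale {E : ℝ} {n₀ : ℕ} (hE : (n₀ : ℝ) + 4 ≤ E) :
    ∃ M : ℕ, n₀ ≤ M + 2 ∧ ((M : ℝ) + 2) ≤ E ∧ E / 2 ≤ (M : ℝ) + 1 := by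
  have hE0 : 0 ≤ E := by
    have : (0 : ℝ) ≤ n₀ := Nat.cast_nonneg _
    linarith
  have h1 : ((⌊E⌋₊ : ℕ) : ℝ) ≤ E := Nat.floor_le hE0
  have h2 : E < ((⌊E⌋₊ : ℕ) : ℝ) + 1 := Nat.lt_floor_add_one E
  have h3 : n₀ + 3 < ⌊E⌋₊ := by
    have : ((n₀ + 3 : ℕ) : ℝ) < ((⌊E⌋₊ : ℕ) : ℝ) := by push_cast; linarith
    exact_mod_cast this
  refine ⟨⌊E⌋₊ - 2, by omega, ?_, ?_⟩
  · have : (((⌊E⌋₊ - 2 : ℕ) : ℝ)) = ((⌊E⌋₊ : ℕ) : ℝ) - 2 := by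
      rw [Nat.cast_sub (by omega)]; push_cast; ring
    rw [this]; linarith
  · have : (((⌊E⌋₊ - 2 : ℕ) : ℝ)) = ((⌊E⌋₊ : ℕ) : ℝ) - 2 := by
      rw [Nat.cast_sub (by omega)]; push_cast; ring
    rw [this]; linarith

/-- The chord slope is small: with `U, w > 0`, `log U − log w ≤ K₁ β`, `0 ≤ K₁ β` and
`E/2 ≤ M + 1`, `E > 0`: `max 0 ((log U − log w)/(M+1)) ≤ 2 K₁ β / E`. [folklore] -/
theorem slope_le {U w K₁ β E : ℝ} {M : ℕ} (hnum : Real.log U - Real.log w ≤ K₁ * β)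
    (hK : 0 ≤ K₁ * β) (hE : 0 < E) (hden : E / 2 ≤ (M : ℝ) + 1) :
    max 0 ((Real.log U - Real.log w) / ((M : ℝ) + 1)) ≤ 2 * K₁ * β / E := by
  have hM : (0 : ℝ) < (M : ℝ) + 1 := by positivity
  have h0 : 0 ≤ 2 * K₁ * β / E := div_nonneg (by linarith) hE.le
  refine max_le h0 ?_
  rcases le_or_gt 0 (Real.log U - Real.log w) with hn | hn
  · calc (Real.log U - Real.log w) / ((M : ℝ) + 1) ≤ K₁ * β / (E / 2) :=
          div_le_div₀ hK hnum (by positivity) hden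
      _ = 2 * K₁ * β / E := by field_simp
  · exact (div_neg_of_neg_of_pos hn hM).le.trans h0

/-- The one-scale window from an upper bound at distance `1` and a lower bound at the scale:
with `0 < w ≤ a_t`, `a_1 ≤ U`, `0 < U` and `ε = max 0 ((log U − log w)/(M+1))`,
`e^{-ε (M+1)} a_1 ≤ a_t`. [folklore] -/
theorem window_of_bounds {a₁ aₜ U w : ℝ} {M : ℕ} (hU : 0 < U) (hw : 0 < w) (ha₁ : a₁ ≤ U)
    (hat : w ≤ aₜ) :
    Real.exp (-(max 0 ((Real.log U - Real.log w) / ((M : ℝ) + 1)) * ((M : ℝ) + 1))) * a₁ ≤ aₜ := by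
  have hM : (0 : ℝ) < (M : ℝ) + 1 := by positivity
  rcases le_or_gt w U with hwU | hUw
  · have hε : max 0 ((Real.log U - Real.log w) / ((M : ℝ) + 1)) =
        (Real.log U - Real.log w) / ((M : ℝ) + 1) :=
      max_eq_right (div_nonneg (sub_nonneg.2 (Real.log_le_log hw hwU)) hM.le)
    rw [hε, show -((Real.log U - Real.log w) / ((M : ℝ) + 1) * ((M : ℝ) + 1)) =
      Real.log w - Real.log U by field_simp; ring, Real.exp_sub, Real.exp_log hw, Real.exp_log hU]
    calc w / U * a₁ ≤ w / U * U := by gcongr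
      _ = w := by field_simp
      _ ≤ aₜ := hat
  · have hε : max 0 ((Real.log U - Real.log w) / ((M : ℝ) + 1)) = 0 :=
      max_eq_left (div_nonpos_of_nonpos_of_nonneg
        (sub_nonpos.2 (Real.log_le_log hU hUw.le)) hM.le)
    rw [hε, zero_mul, neg_zero, Real.exp_zero, one_mul]
    linarith

/-- **`ExponentialWindow → XiExpLowerBound`** (the route target of `XiCompleteMonotonicity`
reduced to its one open crux; `ExponentialWindow` = item stmt-QuantumFields-8936 verbatim,
`XiExpLowerBound` = the record of item 8935). [cite: ChatterjeeYMProb2019, Problem 5.1] -/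
theorem xiExpLowerBound_of_exponentialWindow
    (hW : ∀ (G : Type) [Group G] [TopologicalSpace G] [IsTopologicalGroup G] [CompactSpace G]
      [MeasurableSpace G] [BorelSpace G], IsCompactSimpleLieGroup G → ∀ r : LatticeRep G,
      ∃ β₀ c A : ℝ, ∃ n₀ : ℕ, 0 < c ∧ 0 < A ∧ ∀ β : ℝ, β₀ ≤ β →
        ∀ μ ∈ infiniteVolumeLimitPoints (d := 4) r.ρ β, ∀ n : ℕ, n₀ ≤ n →
          (n : ℝ) ≤ Real.exp (c * β) →
            A / (β ^ 2 * (n : ℝ) ^ 8) ≤ plaquetteCorrFn r.ρ μ ((n : ℤ) • Pi.single (0 : Fin 4) (1 : ℤ))) :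
    Theses.XiCompleteMonotonicity.XiExpLowerBound := by
  intro G _ _ _ _ _ _ hG r
  obtain ⟨β₀, c, A, n₀, hc, hA, hwin⟩ := hW G hG r
  -- constants
  refine ⟨max (max β₀ 1) (Real.log ((n₀ : ℝ) + 4) / c), c,
    2 * (((r.N : ℝ)) ^ 2 + |Real.log A| + 2 + 8 * c), hc, fun β hβ μ hμ => ?_⟩
  have hβ0 : β₀ ≤ β := (le_max_left _ _).trans ((le_max_left _ _).trans hβ)
  have hβ1 : 1 ≤ β := (le_max_right _ _).trans ((le_max_left _ _).trans hβ)
  have hβpos : 0 < β := by linarith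
  have hE : (n₀ : ℝ) + 4 ≤ Real.exp (c * β) := by
    have h1 : Real.log ((n₀ : ℝ) + 4) / c ≤ β := (le_max_right _ _).trans hβ
    have h2 : Real.log ((n₀ : ℝ) + 4) ≤ c * β := by
      rw [div_le_iff₀ hc] at h1; linarith
    exact (Real.log_le_iff_le_exp (by positivity)).1 h2
  obtain ⟨M, hn₀M, hME, hEM⟩ := exists_scale hE
  have hEpos : 0 < Real.exp (c * β) := Real.exp_pos _
  -- the axial sequence and its shape
  have hRP := fun n => AxialLogConvexity.plaquetteCorrFn_axial r.ρ r.continuous hβpos.le hμ n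
  -- the window at the scale `M + 2`
  have hw : 0 < A / (β ^ 2 * (((M + 2 : ℕ) : ℝ)) ^ 8) := by positivity
  have hwin' := hwin β hβ0 μ hμ (M + 2) hn₀M (by push_cast; exact hME)
  have hpos : 0 < plaquetteCorrFn r.ρ μ (((M + 2 : ℕ) : ℤ) • Pi.single (0 : Fin 4) (1 : ℤ)) :=
    hw.trans_le hwin'
  -- the chord slope
  have hU : (0 : ℝ) < (r.N : ℝ) ^ 2 + 1 := by positivity
  have hnum : Real.log (((r.N : ℝ)) ^ 2 + 1) - Real.log (A / (β ^ 2 * (((M + 2 : ℕ) : ℝ)) ^ 8)) ≤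
      (((r.N : ℝ)) ^ 2 + |Real.log A| + 2 + 8 * c) * β := by
    have hM2 : (0 : ℝ) < (M : ℝ) + 2 := by positivity
    rw [Real.log_div hA.ne' (by positivity), Real.log_mul (by positivity) (by positivity),
      Real.log_pow, Real.log_pow]
    push_cast
    have h1 : Real.log (((r.N : ℝ)) ^ 2 + 1) ≤ ((r.N : ℝ)) ^ 2 := by
      have := Real.log_le_sub_one_of_pos hU; linarith
    have h2 : Real.log β ≤ β := (Real.log_le_sub_one_of_pos hβpos).trans (by linarith)
    have h3 : Real.log ((M : ℝ) + 2) ≤ c * β := by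
      rw [← Real.log_exp (c * β)]
      exact Real.log_le_log hM2 hME
    have h4 : -Real.log A ≤ |Real.log A| := neg_le_abs _
    have h5 : ((r.N : ℝ)) ^ 2 ≤ ((r.N : ℝ)) ^ 2 * β := le_mul_of_one_le_right (by positivity) hβ1
    have h6 : |Real.log A| ≤ |Real.log A| * β := le_mul_of_one_le_right (abs_nonneg _) hβ1
    linarith [h1, h2, h3, h4, h5, h6]
  have hK : 0 ≤ (((r.N : ℝ)) ^ 2 + |Real.log A| + 2 + 8 * c) * β := by positivity
  have hslope := slope_le hnum hK hEpos hEM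
  -- the window in chord form
  have hwinM := window_of_bounds (M := M) hU hw
    (((hRP 1).2.2.1).trans (le_add_of_nonneg_right zero_le_one)) hwin'
  -- the chord lemma
  have key := xiDiverges_chord
    (ε := max 0 ((Real.log (((r.N : ℝ)) ^ 2 + 1) -
      Real.log (A / (β ^ 2 * (((M + 2 : ℕ) : ℝ)) ^ 8))) / ((M : ℝ) + 1))) (M := M)
    (a := fun k : ℕ => plaquetteCorrFn r.ρ μ ((k : ℤ) • Pi.single (0 : Fin 4) (1 : ℤ)))
    (le_max_left _ _)
  have key₁ := key (fun n => (hRP n).1) (fun n => (hRP n).2.1) (fun n => (hRP n).2.2.2)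
  have key₂ := key₁ hpos hwinM
  refine ⟨_, _, hpos, le_max_left _ _, hslope.trans_eq ?_, key₂⟩
  rw [Real.exp_neg, div_eq_mul_inv]

/-- **The assembly item of route `XiCompleteMonotonicity`** (stmt-QuantumFields-8945,
`Assembly := AxialLogConvexity → ExponentialWindow → XiExpLowerBound`), hypothesis-explicit, with
the recorded items named by their records; the first hypothesis is not even needed (it is the
theorem `AxialLogConvexity_proof`). [cite: ChatterjeeYMProb2019, Problem 5.1] -/
theorem assembly_xiCompleteMonotonicity
    (_hRP : Theses.XiCompleteMonotonicity.AxialLogConvexity)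
    (hW : ∀ (G : Type) [Group G] [TopologicalSpace G] [IsTopologicalGroup G] [CompactSpace G]
      [MeasurableSpace G] [BorelSpace G], IsCompactSimpleLieGroup G → ∀ r : LatticeRep G,
      ∃ β₀ c A : ℝ, ∃ n₀ : ℕ, 0 < c ∧ 0 < A ∧ ∀ β : ℝ, β₀ ≤ β →
        ∀ μ ∈ infiniteVolumeLimitPoints (d := 4) r.ρ β, ∀ n : ℕ, n₀ ≤ n →
          (n : ℝ) ≤ Real.exp (c * β) →
            A / (β ^ 2 * (n : ℝ) ^ 8) ≤ plaquetteCorrFn r.ρ μ ((n : ℤ) • Pi.single (0 : Fin 4) (1 : ℤ))) :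
    Theses.XiCompleteMonotonicity.XiExpLowerBound :=
  xiExpLowerBound_of_exponentialWindow hW

/-- The two routes' records of `AxialLogConvexity` agree, and it holds. [folklore] -/
theorem axialLogConvexity_xiCompleteMonotonicity :
    Theses.XiCompleteMonotonicity.AxialLogConvexity := AxialLogConvexity_proof

/-- **Corollary: `ExponentialWindow → XiDiverges`** (through `XiExpLowerBound` and the tree's
`xiDiverges_of_xiExpLowerBound`): the exponential window alone forces the axial correlation
length to diverge as `β → ∞`. [cite: ChatterjeeYMProb2019, Problem 5.1] -/
theorem xiDiverges_of_exponentialWindow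
    (hW : ∀ (G : Type) [Group G] [TopologicalSpace G] [IsTopologicalGroup G] [CompactSpace G]
      [MeasurableSpace G] [BorelSpace G], IsCompactSimpleLieGroup G → ∀ r : LatticeRep G,
      ∃ β₀ c A : ℝ, ∃ n₀ : ℕ, 0 < c ∧ 0 < A ∧ ∀ β : ℝ, β₀ ≤ β →
        ∀ μ ∈ infiniteVolumeLimitPoints (d := 4) r.ρ β, ∀ n : ℕ, n₀ ≤ n →
          (n : ℝ) ≤ Real.exp (c * β) →
            A / (β ^ 2 * (n : ℝ) ^ 8) ≤ plaquetteCorrFn r.ρ μ ((n : ℤ) • Pi.single (0 : Fin 4) (1 : ℤ))) :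
    Theses.XiCompleteMonotonicity.XiDiverges :=
  xiDiverges_of_xiExpLowerBound (xiExpLowerBound_of_exponentialWindow hW)

end Summit.QuantumFields.YangMills.Theorems.S28XiExpLowerBound

end
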